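import Summits.QuantumFields.YangMills.Theorems.UnitScaleTiltProp7LODDivergenceAgmonLetters
import Summits.QuantumFields.YangMills.Theorems.UnitScaleTiltProp7MassivePropagatorAgmon
import Summits.QuantumFields.YangMills.Theorems.UnitScaleTiltProp7PcolOfGradientRow
import Summits.QuantumFields.YangMills.Theorems.UnitScaleTiltAxialGaugeChartGlue
import HarnessLib

/-!
# Route `UnitScaleTilt`, crux K1 «MinimiserStabilityRegPr» (stmt-QuantumFields-19200), EX row (5) ∕ STOREY H ∕ C6 — **(β-L²) THE DIVERGENCE-FORM
# AGMON `L²` ROW OF THE LOD RESOLVENT ON `ℓ`-BALLS, BY DUALITY**: for `u = G_a(D*_{U₀} x)` with `‖x(b)‖ ≤ X` on every bond,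
# `Σ_{tdist(y₀,y) ≤ ℓ} ‖u(y)‖² ≤ C_A · ℓ³ · X²`, `C_A` depending on the Combes–Thomas rate `μ` and the (L2′-GAP) constant only

Cell `ym3-torus` (HUMAN RULING D-0037; rung R3 = SU(2) YM₃ on T³ — NOT d = 4, NOT infinite volume, NOT a mass gap, NOT Clay).  Width seat `ym3-torus-px21` (gen 17;
★p1 g28 CHAIR WORD №63 (2) «`hUsup` admitted as a displayed letter of C6; supplier road (β) = the `hWsup` programme run once more for the LOD operator»).
`--supports stmt-QuantumFields-19200 --as helper`; count-neutral; THEOREMS ONLY (0 `def`, 0 `sorry`, 0 `instance`); ONE decl-local `set_option maxHeartbeats 400000 in` on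
★★★`sq_sum_ball_G_DstarL2_le` (README heartbeat rule: the assembly elaborates under the default 200k on the farm but not at the 100k twin budget — DISCLOSED, line-neutral).

WHY.  C6's letter `hUsup` (px13 g17 text `H2LOC-LETTER-hUsup.px13g17.txt` 7916524ae76ffc76: `‖(G(D*_{U₀}x))(y)‖ ≤ Cu·X` whenever `‖x(b)‖ ≤ X`, `G = G_a` the LOD-massive
resolvent `(Δ^η_{U₀} + a·T(ι(Q″·)))⁻¹` of ✓`Prop7ZeroModesOrthKerTopMean` §LOD) is supplied — exactly as STOREY H's `hWsup` — by a bootstrap from the local ½-Hölder letter `hHlocV`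
and an `L²` bound on `ℓ`-balls.  For `hWsup` the `L²` row (cst-p1 g38's (A-ROW) `sq_sum_ball_le_of_massive_divergence`) is coercive through the MASS `1•`; the LOD operator has
no mass term — its coercivity is the (L2′-GAP) ✓`Prop7MassivePropagatorCoercive.coercive_massive`, and the Combes–Thomas conjugation with the `Q″`-commutator defects is already
px5 g11's ✓`Prop7MassivePropagatorAgmon.agmon_rows_exp` — for SITE sources.  THE POINT OF THIS FILE: the divergence-form source `D*x` is reached by DUALITY, with no new energy
identity.  With `χ = e^{−φ}` (`φ = φ_{B(y₀)}` the block-distance weight of ✓`Prop7BlockDistanceWeights.exists_blockDistanceWeight`, slope `μη` per bond) and `v := G(χ²u)`: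
`c₀·Σ_y χ²‖u‖² = ⟪χ²u, G(D*x)⟫ = ⟪G(χ²u), D*x⟫ = ⟪D_{U₀}v, x⟫ ≤ c₀X·Σ_b‖(Dv)(b)‖ ≤ c₀X·(Σ_b χ(b₋)²)^{½}·(Σ_b e^{2φ(b₋)}‖(Dv)(b)‖²)^{½}` (`G` symmetric ✓`isSymmetric_G`, `D* = D†`
✓`adjoint_DL2`), and `e^{φ(b₋)}(Dv)(b) = (D(e^{φ}v))(b) − η⁻¹(e^{φ(b₊)} − e^{φ(b₋)})·Ad(U₀(b))v(b₊)` with `η⁻¹|e^{φ(b₊)} − e^{φ(b₋)}| ≤ ℓ(e^{μη} − 1)·e^{φ(b₊)} ≤ e·μ·e^{φ(b₊)}` —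
so (A-H¹)+(A-L²) AT THE GROWING WEIGHT `e^{+φ}` for the site source `χ²u` (`e^{φ}·χ²u = χu`) close the estimate on `Σχ²‖u‖²`; the ball `tdist(y₀,·) ≤ ℓ` has `χ² ≥ e^{−6μ}`
and `Σ_y χ² ≤ e^{6μ}(2(1 + 1∕(2μ)))³·ℓ³` by the block geometry (W1)(iv)+(W2).

WHAT IS PROVED (ns `…Theorems.Prop7LODDivergenceAgmonRow`; the LOD letters of ✓`Prop7MassivePropagatorAgmon` VERBATIM — `hε₀ hε7 hreg Q″ hseq ι hι T hT a ha` — plus the resolvent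
letter `G hAG` of ✓`Prop7ZeroModesOrthKerTopMean` §LOD; carrier rows from ✓`Prop7LODDivergenceAgmonLetters`).  `inner_G_DstarL2_eq` (duality `⟪g, G_a(D*x)⟫ = ⟪D(G_a g), x⟫`),
★★★ `sq_sum_ball_G_DstarL2_le` — THE ROW, with FILE C's window `hδ`∕`hwin` passed through verbatim — and ★★★ `sq_sum_ball_G_DstarL2_le_kfree` (the same under the K-free window
`3(e·μ)² + a·(25∕8)κ·(e^{3μ} − 1)² ≤ δ₁²`, `κ = c₁((L³)^{K−n})⁻¹∕c₀`; at the pins `c₁ = c₀ℓ³`: `κ = 1`, `C_P² = max 2 (16∕a)` — NO `K`, NO `n`, NO volume).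
HYP-SAT (★★OWNER RULING №42).  Beyond the LOD letters of record (`hseq hι hT hAG`, `RegPr`, inhabited by ✓`exists_intertwiner_of_regPr` ∕ ✓`exists_massive_inverse`) the hypotheses
are a sup row on `x` (inhabited by `x = 0`) and two numeric windows on `(μ, δ₁)`; the conclusion is an explicit real inequality.
HONEST SCOPE.  [Balaban1985BackgroundPropagators] Thm 3.1 (3.43)∕(3.46)-class `L²` row for the LOD propagator in divergence form, by duality from the (3.46)-class rows in the tree;
the DOOR (bootstrap to `hUsup` with `hHlocV`), `hHlocV` itself, `hHωwRow`, EX, 19200 are NOT proved here; nothing about d = 4, the continuum limit or a mass gap; the Yang–Mills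
mass gap is NOT proved.

References: T. Bałaban, CMP **99** (1985) 389–434 [Balaban1985BackgroundPropagators] ((3.3) p.391, (3.8) p.392, (3.11) p.392, (3.24)–(3.25) p.394, (3.40) p.397, Thm 3.1
(3.43)∕(3.46) p.398); CMP **96** (1984) 223–250 [Balaban1984PropagatorsII] (Lemma 2.1 p.234); S. Agmon, *Lectures on exponential decay of solutions of second-order elliptic
equations* (1982) [Agmon1982] (Thm 1.5 p.19).
-/

set_option autoImplicit false

noncomputable section

open scoped BigOperators Matrix.Norms.L2Operator InnerProductSpace ComplexConjugate

namespace Summit.QuantumFields.YangMills.Theorems.Prop7LODDivergenceAgmonRow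

open Literature.MathematicalPhysics.QuantumFieldTheory.Balaban1983to89
open Literature.MathematicalPhysics.QuantumFieldTheory.Balaban1983to89.T3ContinuumYM3Torus
open Finset
open T4Continuum BlockAveraging
open BlockAveraging (Idx)
open B7Prop1Explicit (U1 disp)
open B5Eq118OneStroke (iterBlockOf iterBlock mem_iterBlock card_iterBlock)
open B10Eq27TorusAxialLog (holT transl)
open B7TransferAnalyticMean (meanCLM)
open B4Sect5Torus (TSite tdist tdist_symm)
open B9SectCLatticeCarrier (Bond shift)
open B9Eq311L2Pairing (WL2)
open B11Eq103H1Complex (SiteL2K BondL2K)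
open Summit.QuantumFields.YangMills.Theorems.Prop8Chart (emlIterU)
open T3SectALandauChart (eta eta_pos bgUnits)
open T3PrintedRegularMinimiser (RegPr)
open T3PrintedRegularOrbits (sites_eq)
open T3LevelShift (siteShift)
open Summit.QuantumFields.YangMills.Theorems.Prop7SectET3Transport (periodsT3 siteEquiv siteEquiv_symm_shift)
open Summit.QuantumFields.YangMills.Theorems.Prop7SectET3HilbertLetters (W₂ frobEquiv adBg toL2S toL2S_apply toL2S_symm_apply DL2 DstarL2 covLapSite adjoint_DL2)
open Summit.QuantumFields.YangMills.Theorems.Prop7TwoBackgroundGradientComparison (equiv_DL2_apply norm_inv_eta one_le_periodsT3)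
open Summit.QuantumFields.YangMills.Theorems.Prop7MassivePropagatorAgmon (agmon_rows_exp)
open Summit.QuantumFields.YangMills.Theorems.Prop7PcolOfGradientRow (isSymmetric_G)
open Summit.QuantumFields.YangMills.Theorems.Prop7BlockDistanceWeights (exists_blockDistanceWeight eta_mul_pow_eq_one)
open Summit.QuantumFields.YangMills.Theorems.AxialGaugeChartGlue (site_tdist_symm_le_three_mul_tdist)
open Summit.QuantumFields.YangMills.Theorems.Prop7MassiveDivergenceAgmonRow (re_inner_eq_sum)
open Summit.QuantumFields.YangMills.Theorems.Prop7LODDivergenceAgmonLetters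

/-! ## ★★★ The Agmon `L²` row of `G_a D*_{U₀}` on `ℓ`-balls -/

section LOD

variable (F : T3Family) {n K : ℕ} (h : n ≤ K) {c₀ c₁ : ℝ} [Fact (0 < c₀)] [Fact (0 < c₁)]
  {ε₀ : ℝ} (hε₀ : 0 < ε₀) (hε7 : 10 ^ 7 * (F.L : ℝ) ^ 3 * ε₀ ≤ 1)
  (U₀ : GaugeField (F.P K) 0 (Matrix.specialUnitaryGroup (Fin 2) ℂ)) (hreg : RegPr F n K ε₀ U₀)
  (Q'' : SiteL2K ℂ 3 (periodsT3 F K) c₀ W₂ →ₗ[ℂ] (Site (F.P K) (K - n) → Matrix (Fin 2) (Fin 2) ℂ))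
  (hseq : ∀ lam : Site (F.P K) 0 → Matrix (Fin 2) (Fin 2) ℂ, ∃ ns : (j : ℕ) → Site (F.P K) j → Matrix (Fin 2) (Fin 2) ℂ, ns 0 = lam ∧
      (∀ (j : ℕ) (y : Site (F.P K) (j + 1)), ns (j + 1) y = ns j (emb y) - meanCLM (Idx (F.P K)) (Matrix (Fin 2) (Fin 2) ℂ) fun i : Idx (F.P K) =>
        ns j (emb y) - ((holT (emlIterU j (bgUnits F K U₀)) (emb y) (stairWord i.2.1 (off i.1)) : (Matrix (Fin 2) (Fin 2) ℂ)ˣ) : Matrix (Fin 2) (Fin 2) ℂ) *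
          ns j (transl (emb y) (disp (stairWord i.2.1 (off i.1)))) * (((holT (emlIterU j (bgUnits F K U₀)) (emb y) (stairWord i.2.1 (off i.1)))⁻¹ : (Matrix (Fin 2) (Fin 2) ℂ)ˣ) : Matrix (Fin 2) (Fin 2) ℂ)) ∧
      ns (K - n) = Q'' (toL2S F K c₀ lam))
  (ι : (Site (F.P K) (K - n) → Matrix (Fin 2) (Fin 2) ℂ) →ₗ[ℂ] SiteL2K ℂ 3 (periodsT3 F n) c₁ W₂)
  (hι : ∀ c, ι c = toL2S F n c₁ (fun z => c (siteShift (sites_eq F n K h) z)))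
  (T : SiteL2K ℂ 3 (periodsT3 F n) c₁ W₂ →ₗ[ℂ] SiteL2K ℂ 3 (periodsT3 F K) c₀ W₂)
  (hT : ∀ (l : SiteL2K ℂ 3 (periodsT3 F K) c₀ W₂) (f : SiteL2K ℂ 3 (periodsT3 F n) c₁ W₂), ⟪ι (Q'' l), f⟫_ℂ = ⟪l, T f⟫_ℂ)
  {a : ℝ} (ha : 0 < a)
  (G : SiteL2K ℂ 3 (periodsT3 F K) c₀ W₂ →ₗ[ℂ] SiteL2K ℂ 3 (periodsT3 F K) c₀ W₂)
  (hAG : ∀ f, covLapSite F n K c₀ U₀ (G f) + (a : ℂ) • T (ι (Q'' (G f))) = f)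

include hT hAG in
/-- DUALITY: `⟪g, G_a(D*_{U₀}x)⟫ = ⟪D_{U₀}(G_a g), x⟫` (`G_a` symmetric ✓`isSymmetric_G`, `D* = D†` ✓`adjoint_DL2`). [cite: Balaban1985BackgroundPropagators, (3.8) p.392, (3.24)–(3.25) p.394] -/
theorem inner_G_DstarL2_eq (g : SiteL2K ℂ 3 (periodsT3 F K) c₀ W₂) (x : BondL2K ℂ 3 (periodsT3 F K) c₀ W₂) :
    ⟪g, G (DstarL2 F n K c₀ U₀ x)⟫_ℂ = ⟪DL2 F n K c₀ U₀ (G g), x⟫_ℂ := by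
  rw [← (isSymmetric_G F U₀ Q'' ι T hT G hAG) g (DstarL2 F n K c₀ U₀ x), ← adjoint_DL2, LinearMap.adjoint_inner_right]

include hε₀ hε7 hreg hseq hι hT ha hAG in
set_option maxHeartbeats 400000 in
/-- ★★★ **THE AGMON `L²` ROW OF `G_a D*_{U₀}` ON `ℓ`-BALLS** (the `hArow` socket of the `hUsup` DOOR; FILE C's window passed through VERBATIM).  DATA: a Combes–Thomas rate
`0 < μ ≤ 1` and `δ₁ ≥ 0` with `3η⁻²(e^{μη} − 1)² + a·(25∕8)κ·(e^{3μ} − 1)² ≤ δ₁²` (`κ = c₁((L³)^{K−n})⁻¹∕c₀`) in the window `C_P·δ₁ ≤ 1∕10`, `C_P = √(max 2 (16c₀ℓ³∕(a c₁)))`.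
THEN for `u = G_a(D*_{U₀} x)`, `‖x(b)‖ ≤ X` on every bond, and every site `y₀`:
`Σ_{tdist(y₀,y) ≤ ℓ} ‖u(y)‖² ≤ 3·e^{12μ}·(2(1 + 1∕(2μ)))³·(32·C_P² + 384·e²·μ²·C_P⁴)·ℓ³·X²`, `ℓ = L^{K−n}`.  PROOF: duality (`inner_G_DstarL2_eq`) with the test `χ²u`,
`χ = e^{−φ_{B(y₀)}}`; Cauchy–Schwarz on bonds with `χ(b₋)·e^{φ(b₋)} = 1`; §1 `sum_weightSq_normSq_DL2_le` + ✓`agmon_rows_exp` at the growing weight `e^{+φ}` for the site source `χ²u`;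
§2 for the volume; `χ² ≥ e^{−6μ}` on the ball ((W1)(i′)(iii), `ℓ¹ ≤ 3ℓ^∞`). [cite: Balaban1985BackgroundPropagators, Thm 3.1 (3.43) p.398, (3.46) p.398, (3.40) p.397; Balaban1984PropagatorsII, Lemma 2.1 p.234] -/
theorem sq_sum_ball_G_DstarL2_le {μ δ₁ : ℝ} (hμ : 0 < μ) (hμ1 : μ ≤ 1) (hδ₁ : 0 ≤ δ₁)
    (hδ : 3 * ((eta F n K)⁻¹) ^ 2 * (Real.exp (μ * eta F n K) - 1) ^ 2
        + a * ((25 / 8) * (c₁ * ((((F.P K).L : ℝ) ^ (F.P K).d) ^ (K - n))⁻¹ / c₀)) * (Real.exp (3 * μ) - 1) ^ 2 ≤ δ₁ ^ 2)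
    (hwin : Real.sqrt (max 2 (16 * c₀ * ((F.L : ℝ) ^ (K - n)) ^ 3 / (a * c₁))) * δ₁ ≤ 1 / 10)
    (x : BondL2K ℂ 3 (periodsT3 F K) c₀ W₂) {X : ℝ}
    (hx : ∀ b, ‖WL2.equiv ℂ (fun _ : Bond 3 (periodsT3 F K) => c₀) W₂ x b‖ ≤ X) (y₀ : TSite 3 (periodsT3 F K)) :
    ∑ y ∈ Finset.univ.filter (fun y => tdist (periodsT3 F K) y₀ y ≤ (F.L : ℝ) ^ (K - n)),
        ‖WL2.equiv ℂ (fun _ : TSite 3 (periodsT3 F K) => c₀) W₂ (G (DstarL2 F n K c₀ U₀ x)) y‖ ^ 2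
      ≤ 3 * Real.exp (12 * μ) * (2 * (1 + 1 / (2 * μ))) ^ 3
          * (32 * max 2 (16 * c₀ * ((F.L : ℝ) ^ (K - n)) ^ 3 / (a * c₁)) + 384 * Real.exp 1 ^ 2 * μ ^ 2 * (max 2 (16 * c₀ * ((F.L : ℝ) ^ (K - n)) ^ 3 / (a * c₁))) ^ 2)
          * ((F.L : ℝ) ^ (K - n)) ^ 3 * X ^ 2 := by
  have hc₀ : 0 < c₀ := Fact.out
  have hP1 : ∀ i, 1 ≤ periodsT3 F K i := one_le_periodsT3 F K
  set ℓ : ℝ := (F.L : ℝ) ^ (K - n) with hℓ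
  have hℓ1 : 1 ≤ ℓ := one_le_pow₀ (by exact_mod_cast F.hL.2.le)
  have hℓ0 : 0 < ℓ := by linarith
  set m : ℝ := max 2 (16 * c₀ * ℓ ^ 3 / (a * c₁)) with hm
  have hm0 : 0 ≤ m := le_trans (by norm_num) (le_max_left _ _)
  have hCP2 : Real.sqrt m ^ 2 = m := Real.sq_sqrt hm0
  set u : SiteL2K ℂ 3 (periodsT3 F K) c₀ W₂ := G (DstarL2 F n K c₀ U₀ x) with hu
  -- the weight of the block of `y₀`
  set yc : Site (F.P K) (K - n) := iterBlockOf (K - n) ((siteEquiv F K).symm y₀) with hyc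
  obtain ⟨φ, φc, hφ0, hφb, hφlip, hφc, hφB, hφlow⟩ := exists_blockDistanceWeight F h yc hμ.le
  set χ : TSite 3 (periodsT3 F K) → ℝ := fun y => Real.exp (-φ ((siteEquiv F K).symm y)) with hχ
  set ψ : TSite 3 (periodsT3 F K) → ℝ := fun y => φ ((siteEquiv F K).symm y) with hψ
  have hχψ : ∀ y, χ y * Real.exp (ψ y) = 1 := fun y => by rw [hχ, hψ]; simp only []; rw [← Real.exp_add, neg_add_cancel, Real.exp_zero]
  have hχpos : ∀ y, 0 < χ y := fun y => Real.exp_pos _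
  -- the per-bond slope of `ψ`
  have hψb : ∀ (y : TSite 3 (periodsT3 F K)) (ν : Fin 3), |ψ (shift ν y) - ψ y| ≤ μ * eta F n K := by
    intro y ν
    have hb := hφb ⟨(siteEquiv F K).symm y, ν⟩
    rw [hψ]; simp only []
    rw [siteEquiv_symm_shift]
    exact hb
  -- the test function `g = χ²u` and `v = G g`
  set g : SiteL2K ℂ 3 (periodsT3 F K) c₀ W₂ := (WL2.equiv ℂ (fun _ : TSite 3 (periodsT3 F K) => c₀) W₂).symm fun z => (((χ z) ^ 2 : ℝ) : ℂ) • WL2.equiv ℂ (fun _ : TSite 3 (periodsT3 F K) => c₀) W₂ u z with hg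
  set v : SiteL2K ℂ 3 (periodsT3 F K) c₀ W₂ := G g with hv
  set S : ℝ := ∑ y, χ y ^ 2 * ‖WL2.equiv ℂ (fun _ : TSite 3 (periodsT3 F K) => c₀) W₂ u y‖ ^ 2 with hSdef
  have hS0 : 0 ≤ S := Finset.sum_nonneg fun y _ => by positivity
  -- Step 1: `c₀ S = re ⟪g, u⟫`
  have h1 : (⟪g, u⟫_ℂ).re = c₀ * S := by
    rw [re_inner_eq_sum c₀, hSdef, Finset.mul_sum]
    refine Finset.sum_congr rfl fun y _ => ?_
    have : WL2.equiv ℂ (fun _ : TSite 3 (periodsT3 F K) => c₀) W₂ g y = (((χ y) ^ 2 : ℝ) : ℂ) • WL2.equiv ℂ (fun _ : TSite 3 (periodsT3 F K) => c₀) W₂ u y := by rw [hg, Equiv.apply_symm_apply]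
    rw [this, inner_smul_left, Complex.conj_ofReal, Complex.re_ofReal_mul, inner_self_eq_norm_sq_to_K]
    norm_cast
  -- Step 2: duality and the bond bound
  have h2 : c₀ * S ≤ c₀ * X * ∑ b, ‖WL2.equiv ℂ (fun _ : Bond 3 (periodsT3 F K) => c₀) W₂ (DL2 F n K c₀ U₀ v) b‖ := by
    rw [← h1, hu, inner_G_DstarL2_eq F U₀ Q'' ι T hT G hAG, ← hv]
    exact re_inner_le_of_bond_bound F K c₀ _ x hx
  -- Step 3: Cauchy–Schwarz with `χ(b₋)·e^{ψ(b₋)} = 1`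
  have h3 : (∑ b, ‖WL2.equiv ℂ (fun _ : Bond 3 (periodsT3 F K) => c₀) W₂ (DL2 F n K c₀ U₀ v) b‖) ^ 2
      ≤ (∑ b : Bond 3 (periodsT3 F K), χ b.1 ^ 2) * ∑ b : Bond 3 (periodsT3 F K), Real.exp (ψ b.1) ^ 2 * ‖WL2.equiv ℂ (fun _ : Bond 3 (periodsT3 F K) => c₀) W₂ (DL2 F n K c₀ U₀ v) b‖ ^ 2 := by
    have hcs := Finset.sum_mul_sq_le_sq_mul_sq (Finset.univ : Finset (Bond 3 (periodsT3 F K))) (fun b => χ b.1)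
      (fun b => Real.exp (ψ b.1) * ‖WL2.equiv ℂ (fun _ : Bond 3 (periodsT3 F K) => c₀) W₂ (DL2 F n K c₀ U₀ v) b‖)
    have heq : ∑ b, χ b.1 * (Real.exp (ψ b.1) * ‖WL2.equiv ℂ (fun _ : Bond 3 (periodsT3 F K) => c₀) W₂ (DL2 F n K c₀ U₀ v) b‖) = ∑ b, ‖WL2.equiv ℂ (fun _ : Bond 3 (periodsT3 F K) => c₀) W₂ (DL2 F n K c₀ U₀ v) b‖ :=
      Finset.sum_congr rfl fun b _ => by rw [← mul_assoc, hχψ, one_mul]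
    rw [heq] at hcs
    refine hcs.trans (le_of_eq ?_)
    exact congrArg _ (Finset.sum_congr rfl fun b _ => by rw [mul_pow])
  have hχsum : ∑ b : Bond 3 (periodsT3 F K), χ b.1 ^ 2 = 3 * ∑ y, χ y ^ 2 := by
    rw [Fintype.sum_prod_type, Finset.mul_sum]
    refine Finset.sum_congr rfl fun y _ => ?_
    simp only [Finset.sum_const, Finset.card_univ, Fintype.card_fin, nsmul_eq_mul, Nat.cast_ofNat]
  -- Step 4: the reweighted gradient (§1) and FILE C at the growing weight `e^{ψ}`
  set Ωv : SiteL2K ℂ 3 (periodsT3 F K) c₀ W₂ := (WL2.equiv ℂ (fun _ : TSite 3 (periodsT3 F K) => c₀) W₂).symm fun z => ((Real.exp (ψ z) : ℝ) : ℂ) • WL2.equiv ℂ (fun _ : TSite 3 (periodsT3 F K) => c₀) W₂ v z with hΩv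
  set Ωg : SiteL2K ℂ 3 (periodsT3 F K) c₀ W₂ := (WL2.equiv ℂ (fun _ : TSite 3 (periodsT3 F K) => c₀) W₂).symm fun z => ((Real.exp (ψ z) : ℝ) : ℂ) • WL2.equiv ℂ (fun _ : TSite 3 (periodsT3 F K) => c₀) W₂ g z with hΩg
  have h4 := sum_weightSq_normSq_DL2_le F n K c₀ U₀ ψ hψb v
  rw [← hΩv] at h4
  -- FILE C
  have hAu : covLapSite F n K c₀ U₀ (toL2S F K c₀ ((toL2S F K c₀).symm v)) + (a : ℂ) • T (ι (Q'' (toL2S F K c₀ ((toL2S F K c₀).symm v))))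
      = toL2S F K c₀ ((toL2S F K c₀).symm g) := by
    simp only [LinearEquiv.apply_symm_apply, hv]; exact hAG g
  have hC := agmon_rows_exp F h hε₀ hε7 U₀ hreg Q'' hseq ι hι T hT ha φ φc (θ := μ * eta F n K) (θ' := 3 * μ) (by positivity) hφb hφc hδ₁ hδ hwin
    ((toL2S F K c₀).symm v) ((toL2S F K c₀).symm g) hAu
  rw [toL2S_exp_smul_symm_eq, toL2S_exp_smul_symm_eq] at hC
  have hC' : ‖Ωv‖ ≤ 8 * Real.sqrt m ^ 2 * ‖Ωg‖ ∧ ‖DL2 F n K c₀ U₀ Ωv‖ ^ 2 + a * ‖ι (Q'' Ωv)‖ ^ 2 ≤ (4 * Real.sqrt m * ‖Ωg‖) ^ 2 := hC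
  obtain ⟨hCL2, hCH1⟩ := hC'
  -- `‖Ωg‖² = c₀ S`
  have hΩg_sq : ‖Ωg‖ ^ 2 = c₀ * S := by
    rw [norm_sq_eq_c0_mul_sum c₀, hSdef]
    refine congrArg _ (Finset.sum_congr rfl fun y _ => ?_)
    have e1 : WL2.equiv ℂ (fun _ : TSite 3 (periodsT3 F K) => c₀) W₂ Ωg y = ((Real.exp (ψ y) : ℝ) : ℂ) • WL2.equiv ℂ (fun _ : TSite 3 (periodsT3 F K) => c₀) W₂ g y := by rw [hΩg, Equiv.apply_symm_apply]
    have e2 : WL2.equiv ℂ (fun _ : TSite 3 (periodsT3 F K) => c₀) W₂ g y = (((χ y) ^ 2 : ℝ) : ℂ) • WL2.equiv ℂ (fun _ : TSite 3 (periodsT3 F K) => c₀) W₂ u y := by rw [hg, Equiv.apply_symm_apply]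
    rw [e1, e2, smul_smul, ← Complex.ofReal_mul, norm_smul, Complex.norm_real, Real.norm_of_nonneg (by positivity), mul_pow]
    congr 1
    calc (Real.exp (ψ y) * χ y ^ 2) ^ 2 = (χ y * Real.exp (ψ y)) ^ 2 * χ y ^ 2 := by ring
      _ = χ y ^ 2 := by rw [hχψ, one_pow, one_mul]
  have hDΩv : ‖DL2 F n K c₀ U₀ Ωv‖ ^ 2 ≤ 16 * m * (c₀ * S) := by
    have ha0 : 0 ≤ a * ‖ι (Q'' Ωv)‖ ^ 2 := by positivity
    have : ‖DL2 F n K c₀ U₀ Ωv‖ ^ 2 ≤ (4 * Real.sqrt m * ‖Ωg‖) ^ 2 := by linarith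
    calc ‖DL2 F n K c₀ U₀ Ωv‖ ^ 2 ≤ (4 * Real.sqrt m * ‖Ωg‖) ^ 2 := this
      _ = 16 * Real.sqrt m ^ 2 * ‖Ωg‖ ^ 2 := by ring
      _ = 16 * m * (c₀ * S) := by rw [hCP2, hΩg_sq]
  have hΩv_sq : ‖Ωv‖ ^ 2 ≤ 64 * m ^ 2 * (c₀ * S) := by
    have h0 : 0 ≤ ‖Ωv‖ := norm_nonneg _
    calc ‖Ωv‖ ^ 2 ≤ (8 * Real.sqrt m ^ 2 * ‖Ωg‖) ^ 2 := pow_le_pow_left₀ h0 hCL2 2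
      _ = 64 * (Real.sqrt m ^ 2) ^ 2 * ‖Ωg‖ ^ 2 := by ring
      _ = 64 * m ^ 2 * (c₀ * S) := by rw [hCP2, hΩg_sq]
  -- the defect rate `r ≤ e·μ`
  set r : ℝ := ℓ * (Real.exp (μ * eta F n K) - 1) with hr
  have hr0 : 0 ≤ r := mul_nonneg hℓ0.le (by linarith [Real.one_le_exp (mul_nonneg hμ.le (eta_pos F n K).le)])
  have hr1 : r ≤ Real.exp 1 * μ := ell_mul_exp_sub_one_le F n K hμ.le hμ1
  have hr2 : r ^ 2 ≤ Real.exp 1 ^ 2 * μ ^ 2 := by rw [← mul_pow]; exact pow_le_pow_left₀ hr0 hr1 2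
  -- Step 5: assemble `S ≤ 3 X² M Σχ²`, `M = 32 m + 384 r² m²`
  set M : ℝ := 32 * m + 384 * Real.exp 1 ^ 2 * μ ^ 2 * m ^ 2 with hM
  have hM0 : 0 ≤ M := by positivity
  set Sχ : ℝ := ∑ y, χ y ^ 2 with hSχ
  have hSχ0 : 0 ≤ Sχ := Finset.sum_nonneg fun y _ => sq_nonneg _
  have hgrad : ∑ b : Bond 3 (periodsT3 F K), Real.exp (ψ b.1) ^ 2 * ‖WL2.equiv ℂ (fun _ : Bond 3 (periodsT3 F K) => c₀) W₂ (DL2 F n K c₀ U₀ v) b‖ ^ 2 ≤ M * S := by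
    refine h4.trans ?_
    have e1 : 2 * c₀⁻¹ * ‖DL2 F n K c₀ U₀ Ωv‖ ^ 2 ≤ 2 * c₀⁻¹ * (16 * m * (c₀ * S)) := mul_le_mul_of_nonneg_left hDΩv (by positivity)
    have e2 : 6 * r ^ 2 * c₀⁻¹ * ‖Ωv‖ ^ 2 ≤ 6 * r ^ 2 * c₀⁻¹ * (64 * m ^ 2 * (c₀ * S)) := mul_le_mul_of_nonneg_left hΩv_sq (by positivity)
    have hcc : c₀⁻¹ * c₀ = 1 := inv_mul_cancel₀ hc₀.ne'
    have e3 : 2 * c₀⁻¹ * (16 * m * (c₀ * S)) = 32 * m * S := by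
      calc 2 * c₀⁻¹ * (16 * m * (c₀ * S)) = 32 * m * S * (c₀⁻¹ * c₀) := by ring
        _ = 32 * m * S := by rw [hcc, mul_one]
    have e4 : 6 * r ^ 2 * c₀⁻¹ * (64 * m ^ 2 * (c₀ * S)) = 384 * r ^ 2 * m ^ 2 * S := by
      calc 6 * r ^ 2 * c₀⁻¹ * (64 * m ^ 2 * (c₀ * S)) = 384 * r ^ 2 * m ^ 2 * S * (c₀⁻¹ * c₀) := by ring
        _ = 384 * r ^ 2 * m ^ 2 * S := by rw [hcc, mul_one]
    rw [e3] at e1; rw [e4] at e2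
    have e5 : 384 * r ^ 2 * m ^ 2 * S ≤ 384 * (Real.exp 1 ^ 2 * μ ^ 2) * m ^ 2 * S :=
      mul_le_mul_of_nonneg_right (mul_le_mul_of_nonneg_right (mul_le_mul_of_nonneg_left hr2 (by norm_num)) (sq_nonneg m)) hS0
    calc _ ≤ 32 * m * S + 384 * r ^ 2 * m ^ 2 * S := add_le_add e1 e2
      _ ≤ 32 * m * S + 384 * (Real.exp 1 ^ 2 * μ ^ 2) * m ^ 2 * S := by linarith
      _ = M * S := by rw [hM]; ring
  have hSle : S ≤ 3 * X ^ 2 * M * Sχ := by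
    have h3' : (∑ b, ‖WL2.equiv ℂ (fun _ : Bond 3 (periodsT3 F K) => c₀) W₂ (DL2 F n K c₀ U₀ v) b‖) ^ 2 ≤ 3 * Sχ * (M * S) := by
      refine h3.trans ?_
      rw [hχsum]
      exact mul_le_mul_of_nonneg_left hgrad (mul_nonneg (by norm_num) hSχ0)
    exact real_bootstrap hc₀ hS0 hSχ0 hM0 h2 h3'
  -- Step 6: the volume of `χ²` and the lower bound on the ball
  have hvol : Sχ ≤ Real.exp (6 * μ) * (2 * (1 + 1 / (2 * μ))) ^ 3 * ℓ ^ 3 := by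
    rw [hSχ]
    have e1 : ∑ y, χ y ^ 2 = ∑ x0 : Site (F.P K) 0, Real.exp (-(2 * φ x0)) := by
      rw [← Equiv.sum_comp (siteEquiv F K).symm (fun x0 : Site (F.P K) 0 => Real.exp (-(2 * φ x0)))]
      refine Finset.sum_congr rfl fun y _ => ?_
      rw [hχ]; simp only []; rw [sq, ← Real.exp_add]; congr 1; ring
    rw [e1]
    exact sum_exp_neg_two_phi_le F yc hμ φ hφlow
  have hball : ∀ y ∈ Finset.univ.filter (fun y => tdist (periodsT3 F K) y₀ y ≤ ℓ),
      ‖WL2.equiv ℂ (fun _ : TSite 3 (periodsT3 F K) => c₀) W₂ u y‖ ^ 2 ≤ Real.exp (6 * μ) * (χ y ^ 2 * ‖WL2.equiv ℂ (fun _ : TSite 3 (periodsT3 F K) => c₀) W₂ u y‖ ^ 2) := by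
    intro y hy
    rw [Finset.mem_filter] at hy
    -- `φ(e⁻¹ y) ≤ 3μ`
    have hy0 : φ ((siteEquiv F K).symm y₀) = 0 := hφB _ rfl
    have hd : (Site.tdist ((siteEquiv F K).symm y) ((siteEquiv F K).symm y₀) : ℝ) ≤ 3 * ℓ := by
      have := site_tdist_symm_le_three_mul_tdist F K y y₀
      rw [tdist_symm hP1] at this
      linarith [hy.2]
    have hφy : φ ((siteEquiv F K).symm y) ≤ 3 * μ := by
      have e1 := hφlip ((siteEquiv F K).symm y) ((siteEquiv F K).symm y₀)
      rw [hy0, sub_zero] at e1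
      have e2 : μ * eta F n K * (Site.tdist ((siteEquiv F K).symm y) ((siteEquiv F K).symm y₀) : ℝ) ≤ μ * eta F n K * (3 * ℓ) :=
        mul_le_mul_of_nonneg_left hd (mul_nonneg hμ.le (eta_pos F n K).le)
      have e3 : μ * eta F n K * (3 * ℓ) = 3 * μ := by
        have := eta_mul_pow_eq_one F (n := n) (K := K)
        rw [← hℓ] at this
        calc μ * eta F n K * (3 * ℓ) = 3 * μ * (eta F n K * ℓ) := by ring
          _ = 3 * μ := by rw [this, mul_one]
      linarith [le_abs_self (φ ((siteEquiv F K).symm y))]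
    have hχ2 : 1 ≤ Real.exp (6 * μ) * χ y ^ 2 := by
      rw [hχ]; simp only []
      rw [sq, ← Real.exp_add, ← Real.exp_add, ← Real.exp_zero]
      exact Real.exp_le_exp.2 (by linarith)
    have hn := sq_nonneg ‖WL2.equiv ℂ (fun _ : TSite 3 (periodsT3 F K) => c₀) W₂ u y‖
    calc ‖WL2.equiv ℂ (fun _ : TSite 3 (periodsT3 F K) => c₀) W₂ u y‖ ^ 2 = 1 * ‖WL2.equiv ℂ (fun _ : TSite 3 (periodsT3 F K) => c₀) W₂ u y‖ ^ 2 := (one_mul _).symm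
      _ ≤ (Real.exp (6 * μ) * χ y ^ 2) * ‖WL2.equiv ℂ (fun _ : TSite 3 (periodsT3 F K) => c₀) W₂ u y‖ ^ 2 := mul_le_mul_of_nonneg_right hχ2 hn
      _ = _ := mul_assoc _ _ _
  calc ∑ y ∈ Finset.univ.filter (fun y => tdist (periodsT3 F K) y₀ y ≤ ℓ), ‖WL2.equiv ℂ (fun _ : TSite 3 (periodsT3 F K) => c₀) W₂ u y‖ ^ 2
      ≤ ∑ y ∈ Finset.univ.filter (fun y => tdist (periodsT3 F K) y₀ y ≤ ℓ), Real.exp (6 * μ) * (χ y ^ 2 * ‖WL2.equiv ℂ (fun _ : TSite 3 (periodsT3 F K) => c₀) W₂ u y‖ ^ 2) := Finset.sum_le_sum hball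
    _ ≤ ∑ y, Real.exp (6 * μ) * (χ y ^ 2 * ‖WL2.equiv ℂ (fun _ : TSite 3 (periodsT3 F K) => c₀) W₂ u y‖ ^ 2) :=
        Finset.sum_le_sum_of_subset_of_nonneg (Finset.filter_subset _ _) fun y _ _ => by positivity
    _ = Real.exp (6 * μ) * S := by rw [hSdef, Finset.mul_sum]
    _ ≤ Real.exp (6 * μ) * (3 * X ^ 2 * M * Sχ) := mul_le_mul_of_nonneg_left hSle (Real.exp_pos _).le
    _ ≤ Real.exp (6 * μ) * (3 * X ^ 2 * M * (Real.exp (6 * μ) * (2 * (1 + 1 / (2 * μ))) ^ 3 * ℓ ^ 3)) :=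
        mul_le_mul_of_nonneg_left (mul_le_mul_of_nonneg_left hvol (mul_nonneg (mul_nonneg (by norm_num) (sq_nonneg X)) hM0)) (Real.exp_pos _).le
    _ = 3 * (Real.exp (6 * μ) * Real.exp (6 * μ)) * (2 * (1 + 1 / (2 * μ))) ^ 3 * M * ℓ ^ 3 * X ^ 2 := by ring
    _ = 3 * Real.exp (12 * μ) * (2 * (1 + 1 / (2 * μ))) ^ 3 * M * ℓ ^ 3 * X ^ 2 := by
        rw [← Real.exp_add, show 6 * μ + 6 * μ = 12 * μ by ring]

include hε₀ hε7 hreg hseq hι hT ha hAG in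
/-- ★★★ **THE SAME ROW UNDER THE K-FREE WINDOW**: since `η⁻¹(e^{μη} − 1) = ℓ(e^{μ∕ℓ} − 1) ≤ e·μ` (`ell_mul_exp_sub_one_le`), FILE C's window is implied by
`3(e·μ)² + a·(25∕8)κ·(e^{3μ} − 1)² ≤ δ₁²`, `κ = c₁((L³)^{K−n})⁻¹∕c₀` (`= 1` at the pins `c₁ = c₀ℓ³`), `C_P·δ₁ ≤ 1∕10` — a condition on `(μ, δ₁, a, C_P)` with NO `K`, NO `n`:
`Σ_{tdist(y₀,y) ≤ ℓ} ‖(G_a(D*_{U₀}x))(y)‖² ≤ 3·e^{12μ}·(2(1 + 1∕(2μ)))³·(32·C_P² + 384·e²·μ²·C_P⁴)·ℓ³·X²`.  The `hArow` socket of a DOOR-LOD for C6's `hUsup`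
(px5 g16's ✓`Prop7MassiveDivergenceSupDoor` mechanism with `q := a•T(ι(Q″u))`). [cite: Balaban1985BackgroundPropagators, Thm 3.1 (3.43) p.398, (3.46) p.398; Balaban1984PropagatorsII, Lemma 2.1 p.234] -/
theorem sq_sum_ball_G_DstarL2_le_kfree {μ δ₁ : ℝ} (hμ : 0 < μ) (hμ1 : μ ≤ 1) (hδ₁ : 0 ≤ δ₁)
    (hδ : 3 * (Real.exp 1 * μ) ^ 2
        + a * ((25 / 8) * (c₁ * ((((F.P K).L : ℝ) ^ (F.P K).d) ^ (K - n))⁻¹ / c₀)) * (Real.exp (3 * μ) - 1) ^ 2 ≤ δ₁ ^ 2)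
    (hwin : Real.sqrt (max 2 (16 * c₀ * ((F.L : ℝ) ^ (K - n)) ^ 3 / (a * c₁))) * δ₁ ≤ 1 / 10)
    (x : BondL2K ℂ 3 (periodsT3 F K) c₀ W₂) {X : ℝ}
    (hx : ∀ b, ‖WL2.equiv ℂ (fun _ : Bond 3 (periodsT3 F K) => c₀) W₂ x b‖ ≤ X) (y₀ : TSite 3 (periodsT3 F K)) :
    ∑ y ∈ Finset.univ.filter (fun y => tdist (periodsT3 F K) y₀ y ≤ (F.L : ℝ) ^ (K - n)),
        ‖WL2.equiv ℂ (fun _ : TSite 3 (periodsT3 F K) => c₀) W₂ (G (DstarL2 F n K c₀ U₀ x)) y‖ ^ 2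
      ≤ 3 * Real.exp (12 * μ) * (2 * (1 + 1 / (2 * μ))) ^ 3
          * (32 * max 2 (16 * c₀ * ((F.L : ℝ) ^ (K - n)) ^ 3 / (a * c₁)) + 384 * Real.exp 1 ^ 2 * μ ^ 2 * (max 2 (16 * c₀ * ((F.L : ℝ) ^ (K - n)) ^ 3 / (a * c₁))) ^ 2)
          * ((F.L : ℝ) ^ (K - n)) ^ 3 * X ^ 2 := by
  refine sq_sum_ball_G_DstarL2_le F h hε₀ hε7 U₀ hreg Q'' hseq ι hι T hT ha G hAG hμ hμ1 hδ₁ ?_ hwin x hx y₀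
  have hη := eta_pos F n K
  have hinv : (eta F n K)⁻¹ = (F.L : ℝ) ^ (K - n) := by rw [T3SectALandauChart.eta, inv_pow, inv_inv]
  have h0 : 0 ≤ (eta F n K)⁻¹ * (Real.exp (μ * eta F n K) - 1) :=
    mul_nonneg (inv_nonneg.2 hη.le) (by linarith [Real.one_le_exp (mul_nonneg hμ.le hη.le)])
  have h1 : (eta F n K)⁻¹ * (Real.exp (μ * eta F n K) - 1) ≤ Real.exp 1 * μ := by
    rw [hinv]; exact ell_mul_exp_sub_one_le F n K hμ.le hμ1
  have h2 : ((eta F n K)⁻¹) ^ 2 * (Real.exp (μ * eta F n K) - 1) ^ 2 ≤ (Real.exp 1 * μ) ^ 2 := by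
    rw [← mul_pow]; exact pow_le_pow_left₀ h0 h1 2
  linarith

end LOD

end Summit.QuantumFields.YangMills.Theorems.Prop7LODDivergenceAgmonRow

end
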